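import Mathlib
import Summits.PneNP.PneNP.Theses.OneSlice
import Summits.PneNP.PneNP.Theorems.OneSliceSliceTargetSplit
import Summits.PneNP.PneNP.Theorems.OneSliceMonotoneContinuationDefs
import Summits.PneNP.PneNP.Theorems.OneSliceMonotoneContinuationTransportMono
import Summits.PneNP.PneNP.Theorems.OneSliceMonotoneContinuationLevelAverage
import Summits.PneNP.PneNP.Theorems.OneSliceMonotoneContinuationSamplerExpansion
import Summits.PneNP.PneNP.Theorems.OneSliceMonotoneContinuationBinomialMixing

/-!
# Route OneSlice, crux `MonotoneContinuation` (stmt-PneNP-18471), line `Sketch_ideator1_r1` (ProfileLine) — sampler bounds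

The PROFILE SANDWICH in `L¹(G(n,p))`: for a monotone `f`, the fixed-rate deletion / padding samplers of `f` are within the binomial
average of the profile increments of `f` from its slice-`j` transport (`samplerBounds`). Assembled from the landed stubs
`stub_transportMono`, `stub_levelAverage`, `stub_samplerExpansion`, `stub_binomialMixing`.

Lead prover-line-stmt-PneNP-18471-0, 2026-08-17. Def-free (vocabulary in `OneSliceMonotoneContinuationDefs.lean`).
-/

set_option linter.dupNamespace false -- `Summit.PneNP.PneNP.…`: summit = sub-problem (D-0017)

namespace Summit.PneNP.PneNP.Theorems.MonotoneContinuation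

open Literature.Computability.Complexity hiding supp mem_supp
open Finset hiding slice
open Filter hiding mem_sdiff
open Classical
open Summit.PneNP.PneNP.Theorems (binomialWeight_tail_le binomialWeight_sum_range binomialWeight_nonneg card_slice
  tendsto_mean eventually_window central_add_le mean_ge)
open Summit.PneNP.PneNP.Theorems.ConstantBand.Negative (Edge thr Central slice)
open Summit.PneNP.PneNP.Theorems.SingleThreshold.Negative (pc tendsto_pc pc_nonneg)
open Summit.PneNP.PneNP.Theorems.SliceTargetSplit (Comp nbhd mem_nbhd transport ind l1 nbhdCard ind_nonneg ind_le_one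
  abs_ind_sub_ind l1_comm l1_nonneg l1_triangle l1_eq_sum_slices card_nbhd card_nbhd_of_le card_nbhd_of_ge
  choose_mul_nbhdCard nbhdCard_pos sum_slice_sum_nbhd sum_slice_sum_nbhd_left transport_nonneg transport_sub
  l1_transport_le rdist_eq_l1 transport_ind_mem)

noncomputable section

variable {n : ℕ}

/-! ## Folded forms of the landed stubs -/

/-- Folded `stub_samplerExpansion` (deletion). [folklore] -/
theorem del_expansion (q : ℝ) (f : (Edge n → Bool) → Bool) (y : Edge n → Bool) :
    delSampler q f y = ∑ r ∈ range (edgeCount y + 1), binW (edgeCount y) (1 - q) r * transport r (ind f) y :=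
  stub_samplerExpansion.1 n q f y

/-- Folded `stub_samplerExpansion` (padding). [folklore] -/
theorem pad_expansion (q : ℝ) (f : (Edge n → Bool) → Bool) (y : Edge n → Bool) :
    padSampler q f y = ∑ r ∈ range (n.choose 2 - edgeCount y + 1),
      binW (n.choose 2 - edgeCount y) q r * transport (edgeCount y + r) (ind f) y :=
  stub_samplerExpansion.2 n q f y

/-- Folded `stub_binomialMixing` (thinning). [folklore] -/
theorem binW_thin (N r : ℕ) (p θ : ℝ) : ∑ s ∈ range (N + 1), binW N p s * binW s θ r = binW N (p * θ) r :=
  stub_binomialMixing.1 N r p θ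

/-- Folded `stub_binomialMixing` (superposition). [folklore] -/
theorem binW_sup (N r : ℕ) (p θ : ℝ) (hr : r ≤ N) :
    ∑ s ∈ range (r + 1), binW N p s * binW (N - s) θ (r - s) = binW N (p + θ - p * θ) r :=
  stub_binomialMixing.2 N r p θ hr

/-! ## Elementary facts -/

/-- Binomial weights are nonnegative on `[0,1]`. -/
theorem binW_nonneg {N : ℕ} {p : ℝ} (hp0 : 0 ≤ p) (hp1 : p ≤ 1) (r : ℕ) : 0 ≤ binW N p r :=
  mul_nonneg (mul_nonneg (Nat.cast_nonneg _) (pow_nonneg hp0 _)) (pow_nonneg (sub_nonneg.2 hp1) _)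

/-- Binomial weights sum to `1`. -/
theorem binW_sum (N : ℕ) (p : ℝ) : ∑ r ∈ range (N + 1), binW N p r = 1 :=
  binomialWeight_sum_range (b := binW N p) (fun _ => rfl)

/-- Binomial weights vanish beyond `N`. -/
theorem binW_eq_zero_of_lt {N r : ℕ} (h : N < r) (p : ℝ) : binW N p r = 0 := by
  simp [binW, Nat.choose_eq_zero_of_lt h]

/-- Slices inside the cube are nonempty. -/
theorem card_slice_pos {i : ℕ} (hi : i ≤ n.choose 2) : 0 < #(slice n i) := by
  rw [card_slice]; exact Nat.choose_pos hi

/-- Profiles are nonnegative. -/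
theorem profile_nonneg (f : (Edge n → Bool) → Bool) (i : ℕ) : 0 ≤ profile f i :=
  div_nonneg (sum_nonneg fun x _ => ind_nonneg f x) (Nat.cast_nonneg _)

/-- Profiles are at most `1`. -/
theorem profile_le_one (f : (Edge n → Bool) → Bool) (i : ℕ) : profile f i ≤ 1 := by
  unfold profile
  rcases Nat.eq_zero_or_pos #(slice n i) with h | h
  · rw [h, Nat.cast_zero, div_zero]; exact zero_le_one
  · rw [div_le_one (by exact_mod_cast h)]
    calc ∑ x ∈ slice n i, ind f x ≤ ∑ x ∈ slice n i, (1 : ℝ) := sum_le_sum fun x _ => ind_le_one f x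
      _ = #(slice n i) := by rw [sum_const, nsmul_eq_mul, mul_one]

/-- Profile increments are at most `1` in absolute value. -/
theorem abs_profile_sub_le (f : (Edge n → Bool) → Bool) (i j : ℕ) : |profile f i - profile f j| ≤ 1 := by
  have := profile_nonneg f i; have := profile_le_one f i
  have := profile_nonneg f j; have := profile_le_one f j
  rw [abs_sub_le_iff]; constructor <;> linarith

/-- Regrouping a `G(n,p)`-weighted sum by edge count. -/
theorem sum_eq_sum_slices (p : ℝ) (φ : ℕ → ℝ) (h : (Edge n → Bool) → ℝ) :
    ∑ y, gnpWeight n p y * φ (edgeCount y) * h y =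
      ∑ s ∈ range (n.choose 2 + 1), p ^ s * (1 - p) ^ (n.choose 2 - s) * φ s * ∑ y ∈ slice n s, h y := by
  rw [← sum_fiberwise_of_maps_to (g := edgeCount) (t := range (n.choose 2 + 1)) (s := univ)]
  · refine sum_congr rfl fun s _ => ?_
    rw [mul_sum]
    refine sum_congr rfl fun y hy => ?_
    rw [gnpWeight, (mem_filter.1 hy).2]
  · intro x _
    rw [mem_range, Nat.lt_succ_iff]
    exact samplerExpansion_edgeCount_le x

/-! ## Consequences of `LevelAverage` and `TransportMono` -/

/-- Level sums of a transported indicator. -/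
theorem sum_slice_transport_ind (f : (Edge n → Bool) → Bool) {i j : ℕ}
    (hi : i ≤ n.choose 2) (hj : j ≤ n.choose 2) :
    ∑ y ∈ slice n i, transport j (ind f) y = #(slice n i) * profile f j :=
  stub_levelAverage n i j (ind f) hi hj

/-- **Weighted level identity.** `Σ_y w_p(y) φ(|y|) (T_m 𝟙[f])(y) = profile f m · Σ_s Bin(N,p)(s) φ(s)`. -/
theorem weighted_transport_eq (p : ℝ) (φ : ℕ → ℝ) (f : (Edge n → Bool) → Bool) {m : ℕ}
    (hm : m ≤ n.choose 2) :
    ∑ y, gnpWeight n p y * φ (edgeCount y) * transport m (ind f) y =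
      profile f m * ∑ s ∈ range (n.choose 2 + 1), binW (n.choose 2) p s * φ s := by
  rw [sum_eq_sum_slices, mul_sum]
  refine sum_congr rfl fun s hs => ?_
  have hsN : s ≤ n.choose 2 := Nat.lt_succ_iff.1 (mem_range.1 hs)
  rw [sum_slice_transport_ind f hsN hm, card_slice, binW]
  ring

/-- The profile of a monotone function is non-decreasing in the slice index (inside the cube). -/
theorem profile_mono {f : (Edge n → Bool) → Bool} (hf : Monotone f)
    {r r' : ℕ} (hrr' : r ≤ r') (hr' : r' ≤ n.choose 2) : profile f r ≤ profile f r' := by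
  have h0 : (0 : ℕ) ≤ n.choose 2 := Nat.zero_le _
  have hpos : (0 : ℝ) < #(slice n 0) := by exact_mod_cast card_slice_pos h0
  have key : ∑ y ∈ slice n 0, transport r (ind f) y ≤ ∑ y ∈ slice n 0, transport r' (ind f) y :=
    sum_le_sum fun y _ => stub_transportMono n r r' f hf hrr' hr' y
  rw [sum_slice_transport_ind f h0 (hrr'.trans hr'), sum_slice_transport_ind f h0 hr'] at key
  exact le_of_mul_le_mul_left key hpos

/-- One level of the sampler error with the sign removed: for `r, j ≤ N` and `φ ≥ 0`,
`Σ_y w_p(y) φ(|y|) |T_r − T_j|(y) ≤ (Σ_s Bin(N,p)(s) φ(s)) · |profile r − profile j|`. -/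
theorem weighted_abs_transport_sub_le {p : ℝ} (hp0 : 0 ≤ p) (hp1 : p ≤ 1)
    {φ : ℕ → ℝ} (hφ : ∀ s, 0 ≤ φ s) (f : (Edge n → Bool) → Bool) (hf : Monotone f) {r j : ℕ}
    (hr : r ≤ n.choose 2) (hj : j ≤ n.choose 2) :
    ∑ y, gnpWeight n p y * φ (edgeCount y) * |transport r (ind f) y - transport j (ind f) y| ≤
      (∑ s ∈ range (n.choose 2 + 1), binW (n.choose 2) p s * φ s) * |profile f r - profile f j| := by
  set B : ℝ := ∑ s ∈ range (n.choose 2 + 1), binW (n.choose 2) p s * φ s with hB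
  have hB0 : 0 ≤ B := sum_nonneg fun s _ => mul_nonneg (binW_nonneg hp0 hp1 s) (hφ s)
  rcases le_or_gt r j with hrj | hjr
  · -- `T_r ≤ T_j` pointwise
    have hpt : ∀ y, |transport r (ind f) y - transport j (ind f) y| =
        transport j (ind f) y - transport r (ind f) y := fun y => by
      rw [abs_sub_comm]; exact abs_of_nonneg (sub_nonneg.2 (stub_transportMono n r j f hf hrj hj y))
    simp_rw [hpt, mul_sub]
    rw [sum_sub_distrib, weighted_transport_eq p φ f hj, weighted_transport_eq p φ f hr, ← hB]
    calc profile f j * B - profile f r * B = (profile f j - profile f r) * B := by ring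
      _ ≤ |profile f r - profile f j| * B := by
          refine mul_le_mul_of_nonneg_right ?_ hB0
          rw [abs_sub_comm]; exact le_abs_self _
      _ = B * |profile f r - profile f j| := by ring
  · -- `T_j ≤ T_r` pointwise
    have hpt : ∀ y, |transport r (ind f) y - transport j (ind f) y| =
        transport r (ind f) y - transport j (ind f) y := fun y =>
      abs_of_nonneg (sub_nonneg.2 (stub_transportMono n j r f hf hjr.le hr y))
    simp_rw [hpt, mul_sub]
    rw [sum_sub_distrib, weighted_transport_eq p φ f hj, weighted_transport_eq p φ f hr, ← hB]
    calc profile f r * B - profile f j * B = (profile f r - profile f j) * B := by ring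
      _ ≤ |profile f r - profile f j| * B := mul_le_mul_of_nonneg_right (le_abs_self _) hB0
      _ = B * |profile f r - profile f j| := by ring

/-! ## The sampler bounds (profile sandwich + expansion + binomial mixing) -/

/-- **Deletion sampler bound.** For monotone `f`, `0 ≤ p, q ≤ 1` and `j ≤ N`:
`‖delSampler q f − T_j 𝟙[f]‖_{L¹(G(n,p))} ≤ Σ_r Bin(N, p(1-q))(r) |profile f r − profile f j|`. -/
theorem l1_delSampler_le {p q : ℝ} (hp0 : 0 ≤ p) (hp1 : p ≤ 1) (hq0 : 0 ≤ q) (hq1 : q ≤ 1)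
    (f : (Edge n → Bool) → Bool) (hf : Monotone f) {j : ℕ} (hj : j ≤ n.choose 2) :
    l1 n p (delSampler q f) (transport j (ind f)) ≤
      ∑ r ∈ range (n.choose 2 + 1), binW (n.choose 2) (p * (1 - q)) r * |profile f r - profile f j| := by
  set N := n.choose 2 with hN
  have h1q0 : 0 ≤ 1 - q := sub_nonneg.2 hq1
  have h1q1 : 1 - q ≤ 1 := by linarith
  -- pointwise: `|U y − T_j y| ≤ Σ_{r ≤ N} Bin(|y|,1-q)(r) |T_r y − T_j y|`
  have hpt : ∀ y : Edge n → Bool, |delSampler q f y - transport j (ind f) y| ≤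
      ∑ r ∈ range (N + 1), binW (edgeCount y) (1 - q) r * |transport r (ind f) y - transport j (ind f) y| := by
    intro y
    have hsub : range (edgeCount y + 1) ⊆ range (N + 1) :=
      range_subset_range.2 (Nat.succ_le_succ (samplerExpansion_edgeCount_le y))
    have hext : ∀ g : ℕ → ℝ, ∑ r ∈ range (edgeCount y + 1), binW (edgeCount y) (1 - q) r * g r =
        ∑ r ∈ range (N + 1), binW (edgeCount y) (1 - q) r * g r := by
      intro g
      refine sum_subset hsub fun r _ hr' => ?_
      have : edgeCount y < r := by
        rw [mem_range, not_lt] at hr'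
        omega
      rw [binW_eq_zero_of_lt this, zero_mul]
    have hsum1 : ∑ r ∈ range (N + 1), binW (edgeCount y) (1 - q) r = 1 := by
      have h := hext (fun _ => 1)
      simp only [mul_one] at h
      rw [← h, binW_sum]
    have hU : delSampler q f y = ∑ r ∈ range (N + 1), binW (edgeCount y) (1 - q) r * transport r (ind f) y := by
      rw [del_expansion q f y]; exact hext _
    have hdiff : delSampler q f y - transport j (ind f) y =
        ∑ r ∈ range (N + 1), binW (edgeCount y) (1 - q) r * (transport r (ind f) y - transport j (ind f) y) := by
      simp_rw [mul_sub]
      rw [sum_sub_distrib, ← sum_mul, hsum1, one_mul, hU]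
    rw [hdiff]
    refine (abs_sum_le_sum_abs _ _).trans (le_of_eq (sum_congr rfl fun r _ => ?_))
    rw [abs_mul, abs_of_nonneg (binW_nonneg h1q0 h1q1 r)]
  -- integrate and swap
  calc l1 n p (delSampler q f) (transport j (ind f))
      ≤ ∑ y, gnpWeight n p y * ∑ r ∈ range (N + 1),
          binW (edgeCount y) (1 - q) r * |transport r (ind f) y - transport j (ind f) y| := by
        unfold l1
        exact sum_le_sum fun y _ => mul_le_mul_of_nonneg_left (hpt y) (gnpWeight_nonneg hp0 hp1 y)
    _ = ∑ r ∈ range (N + 1), ∑ y, gnpWeight n p y * binW (edgeCount y) (1 - q) r *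
          |transport r (ind f) y - transport j (ind f) y| := by
        simp_rw [mul_sum, ← mul_assoc]
        exact sum_comm
    _ ≤ ∑ r ∈ range (N + 1), binW N (p * (1 - q)) r * |profile f r - profile f j| := by
        refine sum_le_sum fun r hr => ?_
        have hrN : r ≤ N := Nat.lt_succ_iff.1 (mem_range.1 hr)
        refine (weighted_abs_transport_sub_le hp0 hp1 (φ := fun s => binW s (1 - q) r)
          (fun s => binW_nonneg h1q0 h1q1 r) f hf hrN hj).trans (le_of_eq ?_)
        rw [binW_thin N r p (1 - q)]

/-- **Padding sampler bound.** For monotone `f`, `0 ≤ p, q ≤ 1` and `j ≤ N`: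
`‖padSampler q f − T_j 𝟙[f]‖_{L¹(G(n,p))} ≤ Σ_r Bin(N, p+q-pq)(r) |profile f r − profile f j|`. -/
theorem l1_padSampler_le {p q : ℝ} (hp0 : 0 ≤ p) (hp1 : p ≤ 1) (hq0 : 0 ≤ q) (hq1 : q ≤ 1)
    (f : (Edge n → Bool) → Bool) (hf : Monotone f) {j : ℕ} (hj : j ≤ n.choose 2) :
    l1 n p (padSampler q f) (transport j (ind f)) ≤
      ∑ r ∈ range (n.choose 2 + 1), binW (n.choose 2) (p + q - p * q) r * |profile f r - profile f j| := by
  set N := n.choose 2 with hN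
  -- the level weights of the padding sampler, extended by zero below `|y|`
  set φ : ℕ → ℕ → ℝ := fun r s => if s ≤ r then binW (N - s) q (r - s) else 0 with hφ
  have hφ0 : ∀ r s, 0 ≤ φ r s := fun r s => by
    simp only [hφ]; split_ifs
    · exact binW_nonneg hq0 hq1 _
    · exact le_rfl
  -- pointwise: `|V y − T_j y| ≤ Σ_{r ≤ N} φ r |y| · |T_r y − T_j y|`
  have hpt : ∀ y : Edge n → Bool, |padSampler q f y - transport j (ind f) y| ≤
      ∑ r ∈ range (N + 1), φ r (edgeCount y) * |transport r (ind f) y - transport j (ind f) y| := by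
    intro y
    set s := edgeCount y with hs
    have hsN : s ≤ N := samplerExpansion_edgeCount_le y
    -- `range (N - s + 1)` sums as `range (N+1)` sums with the indicator weights
    have hext : ∀ g : ℕ → ℝ, ∑ r ∈ range (N - s + 1), binW (N - s) q r * g (s + r) =
        ∑ r ∈ range (N + 1), φ r s * g r := by
      intro g
      have hIco : ∑ r ∈ range (N - s + 1), binW (N - s) q r * g (s + r) =
          ∑ r ∈ Ico s (N + 1), binW (N - s) q (r - s) * g r := by
        rw [Finset.sum_Ico_eq_sum_range, show N + 1 - s = N - s + 1 by omega]
        refine sum_congr rfl fun r _ => ?_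
        rw [Nat.add_sub_cancel_left]
      have hfil : Ico s (N + 1) = (range (N + 1)).filter fun r => s ≤ r := by
        ext r; simp only [mem_Ico, mem_filter, mem_range]; omega
      rw [hIco, hfil, sum_filter]
      refine sum_congr rfl fun r _ => ?_
      simp only [hφ]
      split_ifs <;> simp
    have hsum1 : ∑ r ∈ range (N + 1), φ r s = 1 := by
      have h := hext (fun _ => 1)
      simp only [mul_one] at h
      rw [← h, binW_sum]
    have hV : padSampler q f y = ∑ r ∈ range (N + 1), φ r s * transport r (ind f) y := by
      rw [pad_expansion q f y]; exact hext (fun r => transport r (ind f) y)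
    have hdiff : padSampler q f y - transport j (ind f) y =
        ∑ r ∈ range (N + 1), φ r s * (transport r (ind f) y - transport j (ind f) y) := by
      simp_rw [mul_sub]
      rw [sum_sub_distrib, ← sum_mul, hsum1, one_mul, hV]
    rw [hdiff]
    refine (abs_sum_le_sum_abs _ _).trans (le_of_eq (sum_congr rfl fun r _ => ?_))
    rw [abs_mul, abs_of_nonneg (hφ0 r s)]
  calc l1 n p (padSampler q f) (transport j (ind f))
      ≤ ∑ y, gnpWeight n p y * ∑ r ∈ range (N + 1),
          φ r (edgeCount y) * |transport r (ind f) y - transport j (ind f) y| := by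
        unfold l1
        exact sum_le_sum fun y _ => mul_le_mul_of_nonneg_left (hpt y) (gnpWeight_nonneg hp0 hp1 y)
    _ = ∑ r ∈ range (N + 1), ∑ y, gnpWeight n p y * φ r (edgeCount y) *
          |transport r (ind f) y - transport j (ind f) y| := by
        simp_rw [mul_sum, ← mul_assoc]
        exact sum_comm
    _ ≤ ∑ r ∈ range (N + 1), binW N (p + q - p * q) r * |profile f r - profile f j| := by
        refine sum_le_sum fun r hr => ?_
        have hrN : r ≤ N := Nat.lt_succ_iff.1 (mem_range.1 hr)
        refine (weighted_abs_transport_sub_le hp0 hp1 (φ := fun s => φ r s) (hφ0 r) f hf hrN hj).trans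
          (le_of_eq ?_)
        have hfilter : (range (N + 1)).filter (fun s => s ≤ r) = range (r + 1) := by
          ext s; simp only [mem_filter, mem_range]; omega
        have hsumφ : ∑ s ∈ range (N + 1), binW N p s * φ r s = binW N (p + q - p * q) r := by
          calc ∑ s ∈ range (N + 1), binW N p s * φ r s
              = ∑ s ∈ range (N + 1), (if s ≤ r then binW N p s * binW (N - s) q (r - s) else 0) :=
                sum_congr rfl fun s _ => by simp only [hφ]; split_ifs <;> simp
            _ = ∑ s ∈ range (r + 1), binW N p s * binW (N - s) q (r - s) := by rw [← sum_filter, hfilter]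
            _ = binW N (p + q - p * q) r := binW_sup N r p q hrN
        rw [hsumφ]

/-! ## Registered form -/

/-- **Sampler bounds** (registered sub-goal `samplerBounds` of stmt-PneNP-18471): for a monotone `f`, rates `p, q ∈ [0,1]` and a slice
`j ≤ C(n,2)`, the deletion and padding samplers of `f` are within the `Bin(N, p(1-q))`- resp. `Bin(N, p+q-pq)`-average of the
profile increments of `f` from its slice-`j` transport, in `L¹(G(n,p))`. [folklore] -/
theorem samplerBounds :
  ∀ (n : ℕ) (p q : ℝ), 0 ≤ p → p ≤ 1 → 0 ≤ q → q ≤ 1 → ∀ (f : (Edge n → Bool) → Bool), Monotone f → ∀ (j : ℕ), j ≤ n.choose 2 →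
    l1 n p (delSampler q f) (transport j (ind f)) ≤
        ∑ r ∈ range (n.choose 2 + 1), binW (n.choose 2) (p * (1 - q)) r * |profile f r - profile f j| ∧
      l1 n p (padSampler q f) (transport j (ind f)) ≤
        ∑ r ∈ range (n.choose 2 + 1), binW (n.choose 2) (p + q - p * q) r * |profile f r - profile f j| :=
  fun _ _ _ hp0 hp1 hq0 hq1 f hf _ hj =>
    ⟨l1_delSampler_le hp0 hp1 hq0 hq1 f hf hj, l1_padSampler_le hp0 hp1 hq0 hq1 f hf hj⟩

end

end Summit.PneNP.PneNP.Theorems.MonotoneContinuation
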